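import Summits.QuantumFields.BalabanUV.T4Continuum.Support.BlockAverageDbarLinNorms
import Summits.QuantumFields.BalabanUV.T4Continuum.Support.NE3NestedBlockMeanCovariance
import Summits.QuantumFields.BalabanUV.T4Continuum.Support.NE3TangentCovariantStructure
import HarnessLib

/-!
# T⁴ programme, node NE3 — route Π, row Π-R (curved step), file Π-R-W4a: ONE LEVEL OF THE LINEARISED DOUBLE-BAR AVERAGE AT A
# NEAR-IDENTITY BACKGROUND — `‖Qbar L W Y c − linQ L Y c‖ ≤ ((2d+4)L²·δ + (8L + C_sup)·loopRad)·s`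

NE3 (node U1b) formalisation swarm, leaf seat `b2b-balaban-t4-ne3-formalise-leaf-01` (gen 8); FINDING F-ne3leaf01g8-1 and the re-planned row
Π-R-W (`HOME/CLAIMS.log` 2026-08-20 ≈23:04Z), file W4a — the one-level input of the crux estimate W4 (`QbarIter L (j+1) W (covLift φ) ≈ φ`).
THE LEMMA.  Let `W` be unitary in the standard small-field class (`512(d+1)(d+4)L²a ≤ 1`, so every loop variable of (42) is within
`loopRad d L a` of `1`, `SpreadLift.loopBound_of_smallField`), and suppose that every bond variable of `W` starting within `ℓ¹`-distance
`nbRad d L = 2dL + 2L` of the coarse bond's foot `c₋ = L•z` is within `δ` of `1` (a NEAR-IDENTITY BALL — e.g. a regional comb gauge,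
`NE3CombGauge.norm_comb_sub_one_le`).  Then for every direction field `Y` with `‖Y(b)‖ ≤ s` on that ball,
**`‖Qbar L W Y z κ − linQ L Y (L•z) κ‖ ≤ ((2d+4)·L²·δ + (8L + C_sup(d,L))·loopRad d L a)·s`**, `C_sup = 1250(nbRad + L) + 8dL + 2L`
(`norm_Qbar_sub_linQ_le`): the covariant one-level reading is the FLAT straight-line block average `linQ` (B7 (122)∕(125)) up to a RELATIVE
error linear in `δ` and in the plaquette radius.  MECHANISM (all inputs BY NAME): leaf-10's structure theorem
`BlockAverageDbarLinBound.norm_dbarLin_sub_main_le` (`dbarLin = Ad_{V̄(c)⁻¹} S(c) + O(loopRad)·(local ℓ¹ weights)`, S = the transported straight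
segments) with the four weights bounded against the sup exactly as in `BlockAverageDbarLinNorms.norm_dbarLin_le_sup`; the transports are
removed by `AveragingDeficitNearIdentity.norm_dhol_sub_asum_le_of_l1` (`δ(Γ) − A(Γ) = O(|Γ|δ)`), `norm_hol_sub_one_le_of_bonds` (tree words,
`|Γ_{c₋,x}| ≤ dL`) and NE3-R2's `norm_cavg_sub_bseg_le` (`‖V̄(c) − W(Γ_c)‖ ≤ 4·loopRad`), leaving B7's `linQ` verbatim.

CONTENT ([folklore]; 0 sorry; 0 def): §1 two bookkeeping lemmas (`norm_asum_le_lnorm`, `norm_units_inv_sub_one_le'`); §2 the main-term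
comparison `norm_segMain_sub_linQ_le`; §3 **`norm_Qbar_sub_linQ_le`** and the companion sup bound `norm_Qbar_le_sup` (= leaf-10's
`norm_dbarLin_le_sup` read on the coarse lattice with `w = loopRad`).

HONEST FRAMING.  One-level kinematics of OUR objects at one background; nothing about minimisers; (P♮)_W, T-E_w and **NE3 are NOT proved**;
spine PROVED 0∕9; finite T⁴ rung (B)+1 — NOT infinite volume, NOT mass gap, NOT `BetaPertH`, NOT Clay.  PLACEMENT: `Summits/QuantumFields/BalabanUV/`.
HONEST DEPENDENCY (cell page 1): continuum YM on T⁴ ⇐ BetaPertH ∧ nine spine estimates (0/9 proved); BetaPertH ⇐ (D1) ∧ (D4) ∧ CAP+tail;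
G-an2-4 gates asym, D1 and NE2/3/4.
-/

set_option autoImplicit false

open scoped BigOperators Matrix.Norms.L2Operator
open Finset

namespace Summit.QuantumFields.BalabanUV.T4Continuum.NE3QbarNearFlat

open Literature.MathematicalPhysics.QuantumFieldTheory.Balaban1983to89
open B7Prop1Explicit B7Prop2Explicit
open T4AveragingDeficitWall (IsUnitaryCfg IsSkewDir SmallField Ad)
open AveragingDeficitTransport (dhol lnorm lnorm_cons norm_dhol_le norm_Ad_of_unitary mem_U1_of_unitary)
open AveragingDeficitNearIdentity (norm_Ad_sub_le norm_hol_sub_one_le_of_bonds norm_dhol_sub_asum_le_of_l1 lnorm_nonneg)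
open AveragingDeficitLocality (bondsOf l1_le_of_mem_bondsOf)
open AveragingDeficitSideDeriv (loopWord)
open AveragingDeficitChartCalculus (cavg)
open AveragingDeficitBlockDensity (bseg cavg_mem)
open SpreadLift (loopRad loopRad_le loopBound_of_smallField)
open B7Prop3Flat (linQ norm_linQ_le)
open BlockAveragePushDirSplit (dbarLin)
open BlockAverageDbarLinBound (segMain segL1 loopL1 treeL1' norm_dbarLin_sub_main_le)
open BlockAverageDbarLinNorms (lnorm_le_length_mul_sup l1_natCast_smul_e norm_dbarLin_le_sup)
open BlockAverageVaryHolo (nbRad length_loopWord_le l1_sub_self)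
open NE3NestedBlockMeanCovariance (norm_cavg_sub_bseg_le)
open NE3TangentCovariantStructure (Qbar)

noncomputable section

variable {d : ℕ} {n : Type*} [Fintype n] [DecidableEq n]

/-! ## §1 Bookkeeping -/

/-- `‖A(Γ)‖ ≤ Σ_{b⊂Γ}‖A(b)‖`. [folklore] -/
theorem norm_asum_le_lnorm (A : Site d → Fin d → Matrix n n ℂ) : ∀ (x : Site d) (w : List (Letter d)), ‖asum A x w‖ ≤ lnorm A x w
  | x, [] => by simp
  | x, l :: w => by
    rw [asum_cons, lnorm_cons]
    refine (norm_add_le _ _).trans (add_le_add ?_ (norm_asum_le_lnorm A _ w))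
    obtain ⟨μ, b⟩ := l
    cases b <;> simp [stepA]

/-- For a unitary unit, `‖u⁻¹ − 1‖ ≤ ‖u − 1‖`. [folklore] -/
theorem norm_units_inv_sub_one_le' [Nonempty n] {u : (Matrix n n ℂ)ˣ} (hu : u ∈ unitaryUnits (Matrix n n ℂ)) :
    ‖((u⁻¹ : (Matrix n n ℂ)ˣ) : Matrix n n ℂ) - 1‖ ≤ ‖(u : Matrix n n ℂ) - 1‖ :=
  norm_inv_sub_one_le (mem_U1_of_unitary hu)

/-- THE SUP CONSTANT of leaf-10's one-level bound: `C_sup(d,L) = 1250(nbRad + L) + 8dL + 2L`. [folklore] -/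
theorem csup_nonneg (d L : ℕ) : (0 : ℝ) ≤ 1250 * ((nbRad d L : ℝ) + L) + 8 * (d * L) + 2 * L := by positivity

/-! ## §2 The main term against the flat straight-line average -/

section Main

variable [Nonempty n] {L : ℕ} (hL : 1 ≤ L) {W : Site d → Fin d → (Matrix n n ℂ)ˣ} (hWu : IsUnitaryCfg W)

include hL hWu in
/-- **THE TRANSPORTED STRAIGHT SEGMENTS VERSUS `linQ`**: if every bond of `W` starting within `ℓ¹`-distance `nbRad d L` of `q` is within
`δ` of `1` and `‖Y(b)‖ ≤ s` there, then `‖S(c) − linQ L Y q κ‖ ≤ 2(d+1)·L²·δ·s` (`S` = `BlockAverageDbarLinBound.segMain`). [folklore] -/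
theorem norm_segMain_sub_linQ_le (q : Site d) (κ : Fin d) {δ : ℝ} (hδ0 : 0 ≤ δ)
    (hδ : ∀ (x' : Site d) (μ : Fin d), l1 (x' - q) ≤ nbRad d L → ‖((W x' μ : (Matrix n n ℂ)ˣ) : Matrix n n ℂ) - 1‖ ≤ δ)
    (Y : Site d → Fin d → Matrix n n ℂ) {s : ℝ} (hY : ∀ (x' : Site d) (μ : Fin d), l1 (x' - q) ≤ nbRad d L → ‖Y x' μ‖ ≤ s) :
    ‖segMain L W Y q κ - linQ L Y q κ‖ ≤ 2 * ((d : ℝ) + 1) * (L : ℝ) ^ 2 * δ * s := by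
  have hs : 0 ≤ s := (norm_nonneg _).trans (hY q κ (by rw [l1_sub_self]; exact Nat.zero_le _))
  have hwt := BlockAveragePushDirSplit.sum_blockWeight_eq_one (d := d) L hL
  unfold segMain linQ
  rw [← Finset.sum_sub_distrib]
  calc ‖∑ r : Fin d → Fin L, ((((L : ℝ) ^ d)⁻¹) • Ad (hol W q (treeWord (boxVec L r))) (dhol W Y (q + boxVec L r) (seg κ L))
          - (((L : ℝ) ^ d)⁻¹) • asum Y (q + boxVec L r) (seg κ L))‖
      ≤ ∑ r : Fin d → Fin L, ((L : ℝ) ^ d)⁻¹ * (2 * ((d : ℝ) + 1) * (L : ℝ) ^ 2 * δ * s) := by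
        refine (norm_sum_le _ _).trans (Finset.sum_le_sum fun r _ => ?_)
        rw [← smul_sub, norm_smul, norm_inv, norm_pow, Real.norm_natCast]
        refine mul_le_mul_of_nonneg_left ?_ (by positivity)
        set p : Site d := q + boxVec L r with hp
        set T : (Matrix n n ℂ)ˣ := hol W q (treeWord (boxVec L r)) with hT
        have hTu : T ∈ unitaryUnits (Matrix n n ℂ) := hol_mem_of hWu _ _
        have hr : l1 (boxVec L r) ≤ d * L := l1_boxVec_le L r
        -- the weight of the segment against the sup
        have hseg : lnorm Y p (seg κ L) ≤ L * s := by
          have h := lnorm_le_length_mul_sup Y hY (seg κ (L : ℤ)) p (by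
            rw [hp, add_sub_cancel_left, length_seg, Int.natAbs_natCast, nbRad]; omega)
          rwa [length_seg, Int.natAbs_natCast] at h
        -- (a) the transports along the segment
        have ha : ‖dhol W Y p (seg κ L) - asum Y p (seg κ L)‖ ≤ 2 * L * δ * (L * s) := by
          have h := norm_dhol_sub_asum_le_of_l1 hWu Y hδ0 p (seg κ (L : ℤ)) fun x' μ hx' => hδ x' μ (by
            rw [length_seg, Int.natAbs_natCast] at hx'
            have hpq : p - q = boxVec L r := by rw [hp]; abel
            have := l1_add_le (x' - p) (p - q)
            rw [show x' - p + (p - q) = x' - q by abel, hpq] at this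
            rw [nbRad]; omega)
          rw [length_seg, Int.natAbs_natCast] at h
          exact h.trans (mul_le_mul_of_nonneg_left hseg (by positivity))
        -- (b) the transport along the tree word
        have hb : ‖((T : (Matrix n n ℂ)ˣ) : Matrix n n ℂ) - 1‖ ≤ (d * L : ℝ) * δ := by
          have h := norm_hol_sub_one_le_of_bonds hWu q (treeWord (boxVec L r)) fun b hb => hδ b.1 b.2 (by
            have := l1_le_of_mem_bondsOf q _ b hb
            rw [length_treeWord] at this
            rw [nbRad]; omega)
          rw [hT]
          refine h.trans ?_
          rw [length_treeWord]
          exact mul_le_mul_of_nonneg_right (by exact_mod_cast hr) hδ0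
        have hasum : ‖asum Y p (seg κ L)‖ ≤ L * s := (norm_asum_le_lnorm Y p _).trans hseg
        calc ‖Ad T (dhol W Y p (seg κ L)) - asum Y p (seg κ L)‖
            = ‖Ad T (dhol W Y p (seg κ L) - asum Y p (seg κ L)) + (Ad T (asum Y p (seg κ L)) - asum Y p (seg κ L))‖ := by
              rw [T4AveragingDeficitNonAbelian.Ad_sub, sub_add_sub_cancel]
          _ ≤ ‖dhol W Y p (seg κ L) - asum Y p (seg κ L)‖ + 2 * ‖((T : (Matrix n n ℂ)ˣ) : Matrix n n ℂ) - 1‖ * ‖asum Y p (seg κ L)‖ := by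
              refine (norm_add_le _ _).trans (add_le_add ?_ (norm_Ad_sub_le hTu _))
              rw [norm_Ad_of_unitary hTu]
          _ ≤ 2 * L * δ * (L * s) + 2 * ((d * L : ℝ) * δ) * (L * s) := by
              refine add_le_add ha ?_
              have h2 : (0 : ℝ) ≤ 2 * ‖((T : (Matrix n n ℂ)ˣ) : Matrix n n ℂ) - 1‖ := by positivity
              calc 2 * ‖((T : (Matrix n n ℂ)ˣ) : Matrix n n ℂ) - 1‖ * ‖asum Y p (seg κ L)‖
                  ≤ 2 * ‖((T : (Matrix n n ℂ)ˣ) : Matrix n n ℂ) - 1‖ * (L * s) := mul_le_mul_of_nonneg_left hasum h2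
                _ ≤ 2 * ((d * L : ℝ) * δ) * (L * s) := by
                    refine mul_le_mul_of_nonneg_right (mul_le_mul_of_nonneg_left hb (by norm_num)) (by positivity)
          _ = 2 * ((d : ℝ) + 1) * (L : ℝ) ^ 2 * δ * s := by ring
    _ = 2 * ((d : ℝ) + 1) * (L : ℝ) ^ 2 * δ * s := by rw [← Finset.sum_mul, hwt, one_mul]

end Main

/-! ## §3 The one-level near-identity estimate -/

section OneLevel

variable [Nonempty n] {L : ℕ} (hL : 1 ≤ L) {W : Site d → Fin d → (Matrix n n ℂ)ˣ} (hWu : IsUnitaryCfg W) {a : ℝ} (ha : 0 ≤ a)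
  (h512 : 512 * (d + 1) * (d + 4) * (L : ℝ) ^ 2 * a ≤ 1) (hWa : SmallField W a)

include hL hWu ha h512 hWa in
/-- **SUP BOUND OF THE ONE-LEVEL READING** (leaf-10's `norm_dbarLin_le_sup` with `w = loopRad d L a`): for `‖Y(b)‖ ≤ s` on the `nbRad`-ball about
`L•z`, `‖Qbar L W Y z κ‖ ≤ (L + loopRad·C_sup)·s`. [folklore] -/
theorem norm_Qbar_le_sup (z : Site d) (κ : Fin d) (Y : Site d → Fin d → Matrix n n ℂ) {s : ℝ}
    (hY : ∀ (x' : Site d) (μ : Fin d), l1 (x' - (L : ℤ) • z) ≤ nbRad d L → ‖Y x' μ‖ ≤ s) :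
    ‖Qbar L W Y z κ‖ ≤ ((L : ℝ) + loopRad d L a * (1250 * ((nbRad d L : ℝ) + L) + 8 * (d * L) + 2 * L)) * s :=
  norm_dbarLin_le_sup L hL hWu Y _ κ (loopRad_le h512) (loopBound_of_smallField hL hWu ha h512 hWa z κ) hY

include hL hWu ha h512 hWa in
/-- **ONE LEVEL AT A NEAR-IDENTITY BACKGROUND**: if every bond of `W` starting within `ℓ¹`-distance `nbRad d L` of `L•z` is within `δ` of `1`,
then for every `Y` with `‖Y(b)‖ ≤ s` on that ball,
`‖Qbar L W Y z κ − linQ L Y (L•z) κ‖ ≤ ((2d+4)·L²·δ + (8L + C_sup)·loopRad d L a)·s`, `C_sup = 1250(nbRad + L) + 8dL + 2L`. [folklore] -/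
theorem norm_Qbar_sub_linQ_le (z : Site d) (κ : Fin d) {δ : ℝ} (hδ0 : 0 ≤ δ)
    (hδ : ∀ (x' : Site d) (μ : Fin d), l1 (x' - (L : ℤ) • z) ≤ nbRad d L → ‖((W x' μ : (Matrix n n ℂ)ˣ) : Matrix n n ℂ) - 1‖ ≤ δ)
    (Y : Site d → Fin d → Matrix n n ℂ) {s : ℝ} (hY : ∀ (x' : Site d) (μ : Fin d), l1 (x' - (L : ℤ) • z) ≤ nbRad d L → ‖Y x' μ‖ ≤ s) :
    ‖Qbar L W Y z κ - linQ L Y ((L : ℤ) • z) κ‖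
      ≤ ((2 * (d : ℝ) + 4) * (L : ℝ) ^ 2 * δ
          + (8 * (L : ℝ) + (1250 * ((nbRad d L : ℝ) + L) + 8 * (d * L) + 2 * L)) * loopRad d L a) * s := by
  set q : Site d := (L : ℤ) • z with hq
  set w : ℝ := loopRad d L a with hw
  set B : (Matrix n n ℂ)ˣ := bavg L W q κ with hB
  have hw0 : 0 ≤ w := by rw [hw, loopRad]; positivity
  have hw32 : w ≤ 1 / 32 := loopRad_le h512
  have hWcx := loopBound_of_smallField hL hWu ha h512 hWa z κ
  have hs : 0 ≤ s := (norm_nonneg _).trans (hY q κ (by rw [l1_sub_self]; exact Nat.zero_le _))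
  have hwt := BlockAveragePushDirSplit.sum_blockWeight_eq_one (d := d) L hL
  -- the four local weights against the sup (as in leaf-10's `norm_dbarLin_le_sup`)
  have hseg0 : lnorm Y q (seg κ L) ≤ L * s := by
    have h := lnorm_le_length_mul_sup Y hY (seg κ (L : ℤ)) q (by rw [l1_sub_self, length_seg, Int.natAbs_natCast, nbRad]; omega)
    rwa [length_seg, Int.natAbs_natCast] at h
  have hloopL1 : loopL1 L Y q κ ≤ (nbRad d L : ℝ) * s := by
    unfold loopL1
    calc _ ≤ ∑ _r : Fin d → Fin L, ((L : ℝ) ^ d)⁻¹ * ((nbRad d L : ℝ) * s) := by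
          refine Finset.sum_le_sum fun r _ => mul_le_mul_of_nonneg_left ?_ (by positivity)
          have h := lnorm_le_length_mul_sup Y hY (loopWord L κ (boxVec L r)) q (by
            rw [l1_sub_self, zero_add]; exact length_loopWord_le L κ r)
          exact h.trans (mul_le_mul_of_nonneg_right (by exact_mod_cast length_loopWord_le L κ r) hs)
      _ = (nbRad d L : ℝ) * s := by rw [← Finset.sum_mul, hwt, one_mul]
  have htreeL1 : treeL1' L Y q κ ≤ (d * L : ℝ) * s := by
    unfold treeL1'
    calc _ ≤ ∑ _r : Fin d → Fin L, ((L : ℝ) ^ d)⁻¹ * ((d * L : ℝ) * s) := by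
          refine Finset.sum_le_sum fun r _ => mul_le_mul_of_nonneg_left ?_ (by positivity)
          have hlen : (treeWord (boxVec L r)).length ≤ d * L := by rw [length_treeWord]; exact l1_boxVec_le L r
          have hl := l1_natCast_smul_e (d := d) L κ
          have h := lnorm_le_length_mul_sup Y hY (treeWord (boxVec L r)) (q + (L : ℤ) • e κ) (by
            rw [add_sub_cancel_left, hl, length_treeWord, nbRad]; have := l1_boxVec_le L r; omega)
          exact h.trans (mul_le_mul_of_nonneg_right (by exact_mod_cast hlen) hs)
      _ = (d * L : ℝ) * s := by rw [← Finset.sum_mul, hwt, one_mul]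
  -- (1) `dbarLin − Ad_{B⁻¹} S = O(w)`
  have h1 : ‖dbarLin L W Y q κ - Ad B⁻¹ (segMain L W Y q κ)‖
      ≤ w * (1250 * ((nbRad d L : ℝ) + L) + 8 * (d * L) + 2 * L) * s := by
    have h := norm_dbarLin_sub_main_le L hL hWu Y q κ hw32 hWcx
    refine h.trans ?_
    have h1250 : (0 : ℝ) ≤ 1250 := by norm_num
    nlinarith [mul_nonneg hw0 hs, hloopL1, htreeL1, hseg0, hs, hw0]
  -- (2) `Ad_{B⁻¹}(S − linQ)`: the transports inside the block
  have hBu : B ∈ unitaryUnits (Matrix n n ℂ) := by rw [hB, hq]; exact cavg_mem hL hWu ha h512 hWa z κ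
  have hBiu : B⁻¹ ∈ unitaryUnits (Matrix n n ℂ) := (unitaryUnits _).inv_mem hBu
  have h2 : ‖Ad B⁻¹ (segMain L W Y q κ) - Ad B⁻¹ (linQ L Y q κ)‖ ≤ 2 * ((d : ℝ) + 1) * (L : ℝ) ^ 2 * δ * s := by
    rw [← T4AveragingDeficitNonAbelian.Ad_sub, norm_Ad_of_unitary hBiu]
    exact norm_segMain_sub_linQ_le hL hWu q κ hδ0 hδ Y hY
  -- (3) `(Ad_{B⁻¹} − 1) linQ`: the averaged bond is within `Lδ + 4w` of `1`
  have hlinQ : ‖linQ L Y q κ‖ ≤ L * s :=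
    norm_linQ_le Y q (nbRad d L) hs (fun x' μ h => hY x' μ h) L hL q κ (by rw [l1_sub_self, nbRad]; omega)
  have hB1 : ‖((B : (Matrix n n ℂ)ˣ) : Matrix n n ℂ) - 1‖ ≤ L * δ + 4 * w := by
    have hcb : ‖((B : (Matrix n n ℂ)ˣ) : Matrix n n ℂ) - bseg L W z κ‖ ≤ 4 * w := by
      rw [hB, hq]; exact norm_cavg_sub_bseg_le hL hWu ha h512 hWa z κ
    have hsg : ‖((bseg L W z κ : (Matrix n n ℂ)ˣ) : Matrix n n ℂ) - 1‖ ≤ L * δ := by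
      unfold bseg
      have h := norm_hol_sub_one_le_of_bonds hWu q (seg κ (L : ℤ)) fun b hb => hδ b.1 b.2 (by
        have := l1_le_of_mem_bondsOf q _ b hb
        rw [length_seg, Int.natAbs_natCast] at this
        rw [nbRad]; omega)
      rw [length_seg, Int.natAbs_natCast] at h
      rw [← hq]
      exact h
    calc ‖((B : (Matrix n n ℂ)ˣ) : Matrix n n ℂ) - 1‖
        = ‖(((B : (Matrix n n ℂ)ˣ) : Matrix n n ℂ) - bseg L W z κ) + (((bseg L W z κ : (Matrix n n ℂ)ˣ) : Matrix n n ℂ) - 1)‖ := by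
          rw [sub_add_sub_cancel]
      _ ≤ 4 * w + L * δ := (norm_add_le _ _).trans (add_le_add hcb hsg)
      _ = L * δ + 4 * w := by ring
  have h3 : ‖Ad B⁻¹ (linQ L Y q κ) - linQ L Y q κ‖ ≤ 2 * (L * δ + 4 * w) * (L * s) := by
    refine (norm_Ad_sub_le hBiu _).trans ?_
    have hinv : ‖(((B⁻¹ : (Matrix n n ℂ)ˣ)) : Matrix n n ℂ) - 1‖ ≤ L * δ + 4 * w := (norm_units_inv_sub_one_le' hBu).trans hB1
    have h2' : (0 : ℝ) ≤ 2 * ‖(((B⁻¹ : (Matrix n n ℂ)ˣ)) : Matrix n n ℂ) - 1‖ := by positivity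
    calc 2 * ‖(((B⁻¹ : (Matrix n n ℂ)ˣ)) : Matrix n n ℂ) - 1‖ * ‖linQ L Y q κ‖
        ≤ 2 * ‖(((B⁻¹ : (Matrix n n ℂ)ˣ)) : Matrix n n ℂ) - 1‖ * (L * s) := mul_le_mul_of_nonneg_left hlinQ h2'
      _ ≤ 2 * (L * δ + 4 * w) * (L * s) := mul_le_mul_of_nonneg_right (mul_le_mul_of_nonneg_left hinv (by norm_num)) (by positivity)
  -- assemble: `Qbar L W Y z κ = dbarLin L W Y (L•z) κ`
  have hQ : Qbar L W Y z κ = dbarLin L W Y q κ := rfl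
  rw [hQ]
  calc ‖dbarLin L W Y q κ - linQ L Y q κ‖
      = ‖(dbarLin L W Y q κ - Ad B⁻¹ (segMain L W Y q κ)) + (Ad B⁻¹ (segMain L W Y q κ) - Ad B⁻¹ (linQ L Y q κ))
          + (Ad B⁻¹ (linQ L Y q κ) - linQ L Y q κ)‖ := by rw [sub_add_sub_cancel, sub_add_sub_cancel]
    _ ≤ w * (1250 * ((nbRad d L : ℝ) + L) + 8 * (d * L) + 2 * L) * s + 2 * ((d : ℝ) + 1) * (L : ℝ) ^ 2 * δ * s
          + 2 * (L * δ + 4 * w) * (L * s) :=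
        (norm_add_le _ _).trans (add_le_add ((norm_add_le _ _).trans (add_le_add h1 h2)) h3)
    _ = ((2 * (d : ℝ) + 4) * (L : ℝ) ^ 2 * δ
          + (8 * (L : ℝ) + (1250 * ((nbRad d L : ℝ) + L) + 8 * (d * L) + 2 * L)) * w) * s := by ring

end OneLevel

end

end Summit.QuantumFields.BalabanUV.T4Continuum.NE3QbarNearFlat
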